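import Literature.AlgebraicGeometry.HodgeTheory.AbelianVarietyPrimeOrderAutomorphismJacobianRange
import HarnessLib

/-!
# Example 2.2 (Zarhin): for `p = 3` the Jacobian range `{𝐚 : ∃ 𝐛 ∈ ℤ_+^G}` has `(g+5)/3`, `(g+1)/3`, `(g+3)/3` elements
# according as `g ≡ 1, 2, 0 (mod 3)`

Family `hodge`, lane `lit-hodgefound` (seat p03, GEN 35 «the analytic type of a finite-order automorphism», row g35-#10; sequel of
g35-#7 `AbelianVarietyPrimeOrderAutomorphismJacobianRange`), topic `Literature/AlgebraicGeometry/HodgeTheory`.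
Theorems only: no definition, no instance, no named fact (net Literature debt 0).

For `p = 3` an admissible function is a pair `(𝐚(1), 𝐚(2)) ∈ ℤ_+²` with `𝐚(1) + 𝐚(2) = g` (`g + 1` of them, Remark 1.2 (ii)),
and by Example 2.2 / g35-#7 it is bound to a nonnegative `𝐛` by `3(𝐚(1)+1) = 2𝐛(1) + 𝐛(2)`, `3(𝐚(2)+1) = 𝐛(1) + 2𝐛(2)` iff
`𝐚(2) ≤ 2𝐚(1) + 1` and `𝐚(1) ≤ 2𝐚(2) + 1` (then `𝐛(1) = 2𝐚(1) − 𝐚(2) + 1`, `𝐛(2) = 2𝐚(2) − 𝐚(1) + 1`), i.e. iff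
`⌈(g−1)/3⌉ ≤ 𝐚(1) ≤ ⌊(2g+1)/3⌋`.  Zarhin lists these `𝐚` by the residue of `g`: `𝐚(1) = k + d (0 ≤ d ≤ k+1)` for `g = 3k+1`
(`k + 2 = (g+5)/3` of them), `𝐚(1) = (k+1) + d (0 ≤ d ≤ k)` for `g = 3k+2` (`k + 1 = (g+1)/3`), `𝐚(1) = k + d (0 ≤ d ≤ k)` for
`g = 3k` (`k + 1 = (g+3)/3`).  This file proves the solvability criterion and the three counts.

## Sources, verbatim (held text `paper:arxiv-2109.06794`)

Yu. G. Zarhin, *Jacobians with automorphisms of prime order*, Math. Research Reports (2021) = arXiv:2109.06794, §2 Example 2.2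
(chunk p0006 L158–L200, p0007 L1–L95): «Let `p = 3`. The number of admissible functions is `(g+1)`. […] the conditions on `𝐛`
are as follows. `𝐛(1), 𝐛(2) ∈ ℤ_+`, `𝐛(1) + 𝐛(2) = g + 2`, `𝐛(1) ≡ 𝐛(2) mod 3`. The list (and number) of corresponding `𝐚`
depends on `g mod 3`. […] (i) `g ≡ 1 mod 3`, i.e., `g = 3k+1` […] `𝐚(1) = k + d, 𝐚(2) = (2k+1) − d; d = 0, …, k+1`. The number
of `𝐚`'s is `k + 2 = (g+5)/3`. (ii) `g ≡ 2 mod 3`, i.e., `g = 3k+2` […] `𝐚(1) = (k+1) + d, 𝐚(2) = (2k+1) − d; d = 0, …, k` […]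
The number of `𝐚`'s is `k + 1 = (g+1)/3`. (iii) `g ≡ 0 mod 3`, i.e., `g = 3k` […] `𝐚(1) = k + d, 𝐚(2) = 2k − d; d = 0, …, k`
[…] The number of `𝐚`'s is `k + 1 = (g+3)/3`».

## What is proved (namespace `Literature.AlgebraicGeometry.HodgeTheory.PrimeOrderRotation`)

* `exists_rotation_three_iff` (for `a₁ + a₂ = g`: `(∃ b₁ b₂ ∈ ℕ, 3(a₁+1) = 2b₁ + b₂ ∧ 3(a₂+1) = b₁ + 2b₂) ↔
  (a₂ ≤ 2a₁ + 1 ∧ a₁ ≤ 2a₂ + 1)`), `mem_jacobianRange_three_iff` (`↔ (g+1)/3 ≤ a₁ ≤ (2g+1)/3`, integer division),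
  **`card_jacobianRange_three`** (`#{a₁ ≤ g : g − a₁ ≤ 2a₁+1 ∧ a₁ ≤ 2(g−a₁)+1} = (2g+1)/3 − (g+1)/3 + 1`), and the three
  residues **`card_jacobianRange_three_of_mod_eq_one`** (`= (g+5)/3`), **`…_of_mod_eq_two`** (`= (g+1)/3`),
  **`…_of_mod_eq_zero`** (`= (g+3)/3`); `card_jacobianRange_three_le` (`≤ g + 1 =` the number of admissible functions, with
  equality iff `g ≤ 1`).

## References

* [Zarhin2021PrimeOrderJacobians] Yu. G. Zarhin, Math. Research Reports (2021), arXiv:2109.06794, §1 Rem. 1.2 (ii), §2 Example 2.2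
  (chunks p0003, p0006–p0007).
-/

namespace Literature.AlgebraicGeometry.HodgeTheory

namespace PrimeOrderRotation

/-! ## Example 2.2: the Jacobian range for `p = 3` and its size -/

section ThreeCount

/-- **Solvability for `p = 3`: nonnegative `𝐛(1), 𝐛(2)` with `3(𝐚(1)+1) = 2𝐛(1) + 𝐛(2)`, `3(𝐚(2)+1) = 𝐛(1) + 2𝐛(2)` exist iff
`𝐚(2) ≤ 2𝐚(1) + 1` and `𝐚(1) ≤ 2𝐚(2) + 1`** (then `𝐛(1) = 2𝐚(1) − 𝐚(2) + 1`, `𝐛(2) = 2𝐚(2) − 𝐚(1) + 1`; the congruence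
`𝐛(1) ≡ 𝐛(2) mod 3` is automatic). [cite: Zarhin2021PrimeOrderJacobians, §2 Example 2.2 (chunk p0006 L162–L200, p0007 L1–L95)] -/
theorem exists_rotation_three_iff (a₁ a₂ : ℕ) :
    (∃ b₁ b₂ : ℕ, 3 * (a₁ + 1) = 2 * b₁ + b₂ ∧ 3 * (a₂ + 1) = b₁ + 2 * b₂) ↔ (a₂ ≤ 2 * a₁ + 1 ∧ a₁ ≤ 2 * a₂ + 1) := by
  constructor
  · rintro ⟨b₁, b₂, h1, h2⟩
    omega
  · rintro ⟨h1, h2⟩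
    exact ⟨2 * a₁ + 1 - a₂, 2 * a₂ + 1 - a₁, by omega, by omega⟩

/-- For `𝐚(1) + 𝐚(2) = g`: **`𝐚` lies in the Jacobian range iff `⌈(g−1)/3⌉ ≤ 𝐚(1) ≤ ⌊(2g+1)/3⌋`**, i.e.
`(g+1)/3 ≤ 𝐚(1) ≤ (2g+1)/3` in integer division («`𝐚(1) = k + d`, …»).
[cite: Zarhin2021PrimeOrderJacobians, §2 Example 2.2 (chunk p0007 L1–L95)] -/
theorem mem_jacobianRange_three_iff {g a₁ a₂ : ℕ} (hg : a₁ + a₂ = g) :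
    (a₂ ≤ 2 * a₁ + 1 ∧ a₁ ≤ 2 * a₂ + 1) ↔ ((g + 1) / 3 ≤ a₁ ∧ a₁ ≤ (2 * g + 1) / 3) := by
  omega

/-- **Example 2.2, the count: `#{𝐚(1) ∈ [0, g] : (𝐚(1), g − 𝐚(1)) in the Jacobian range} = ⌊(2g+1)/3⌋ − ⌊(g+1)/3⌋ + 1`.**
[cite: Zarhin2021PrimeOrderJacobians, §2 Example 2.2 (chunk p0007 L1–L95)] -/
theorem card_jacobianRange_three (g : ℕ) :
    ((Finset.range (g + 1)).filter fun a₁ ↦ g - a₁ ≤ 2 * a₁ + 1 ∧ a₁ ≤ 2 * (g - a₁) + 1).card =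
      (2 * g + 1) / 3 - (g + 1) / 3 + 1 := by
  have hI : ((Finset.range (g + 1)).filter fun a₁ ↦ g - a₁ ≤ 2 * a₁ + 1 ∧ a₁ ≤ 2 * (g - a₁) + 1) =
      Finset.Icc ((g + 1) / 3) ((2 * g + 1) / 3) := by
    ext a₁
    simp only [Finset.mem_filter, Finset.mem_range, Finset.mem_Icc]
    omega
  rw [hI, Nat.card_Icc]
  omega

/-- **Example 2.2 (i): `g = 3k + 1` ⇒ `k + 2 = (g+5)/3` Jacobian types** («`𝐚(1) = k + d, 𝐚(2) = (2k+1) − d; d = 0, …, k+1`.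
The number of `𝐚`'s is `k+2 = (g+5)/3`»). [cite: Zarhin2021PrimeOrderJacobians, §2 Example 2.2 (i) (chunk p0006 L185–L200, p0007 L1–L20)] -/
theorem card_jacobianRange_three_of_mod_eq_one {g : ℕ} (hg : g % 3 = 1) :
    ((Finset.range (g + 1)).filter fun a₁ ↦ g - a₁ ≤ 2 * a₁ + 1 ∧ a₁ ≤ 2 * (g - a₁) + 1).card = (g + 5) / 3 := by
  rw [card_jacobianRange_three]
  omega

/-- **Example 2.2 (ii): `g = 3k + 2` ⇒ `k + 1 = (g+1)/3` Jacobian types** («`𝐚(1) = (k+1) + d, 𝐚(2) = (2k+1) − d; d = 0, …, k`.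
The number of `𝐚`'s is `k+1 = (g+1)/3`»). [cite: Zarhin2021PrimeOrderJacobians, §2 Example 2.2 (ii) (chunk p0007 L22–L62)] -/
theorem card_jacobianRange_three_of_mod_eq_two {g : ℕ} (hg : g % 3 = 2) :
    ((Finset.range (g + 1)).filter fun a₁ ↦ g - a₁ ≤ 2 * a₁ + 1 ∧ a₁ ≤ 2 * (g - a₁) + 1).card = (g + 1) / 3 := by
  rw [card_jacobianRange_three]
  omega

/-- **Example 2.2 (iii): `g = 3k` ⇒ `k + 1 = (g+3)/3` Jacobian types** («`𝐚(1) = k + d, 𝐚(2) = 2k − d; d = 0, …, k` […] The number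
of `𝐚`'s is `k+1 = (g+3)/3`»). [cite: Zarhin2021PrimeOrderJacobians, §2 Example 2.2 (iii) (chunk p0007 L64–L95)] -/
theorem card_jacobianRange_three_of_mod_eq_zero {g : ℕ} (hg : g % 3 = 0) :
    ((Finset.range (g + 1)).filter fun a₁ ↦ g - a₁ ≤ 2 * a₁ + 1 ∧ a₁ ≤ 2 * (g - a₁) + 1).card = (g + 3) / 3 := by
  rw [card_jacobianRange_three]
  omega

/-- **Of the `g + 1` admissible functions for `p = 3` (Remark 1.2 (ii)), at most a third (rounded up) are Jacobian types:
`#(Jacobian range) ≤ g + 1`, with equality iff `g ≤ 1`.** [cite: Zarhin2021PrimeOrderJacobians, §1 Rem. 1.2 (ii) (chunk p0003 L86–L89),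
§2 Example 2.2 (chunk p0006 L158–L160, p0007 L1–L95)] -/
theorem card_jacobianRange_three_le (g : ℕ) :
    ((Finset.range (g + 1)).filter fun a₁ ↦ g - a₁ ≤ 2 * a₁ + 1 ∧ a₁ ≤ 2 * (g - a₁) + 1).card ≤ g + 1 ∧
      (((Finset.range (g + 1)).filter fun a₁ ↦ g - a₁ ≤ 2 * a₁ + 1 ∧ a₁ ≤ 2 * (g - a₁) + 1).card = g + 1 ↔ g ≤ 1) := by
  rw [card_jacobianRange_three]
  omega

end ThreeCount

end PrimeOrderRotation

end Literature.AlgebraicGeometry.HodgeTheory
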